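import Mathlib
import Summits.KontsevichZagierPeriods.Zeta5Search.WedgeDictionaryOneTopKernel
import Literature.Analysis.Complex.ExtremalLength
import HarnessLib

/-!
# The one-top datum `D2 = I(1,0,1,0,1,1,0,1)`, II: the `t₁`- and `t₃`-steps and the linear substitution
# (cell `pub-zeta5`, seat ct-1 g21; item (3) of the wedge-dictionary programme; gen-1 g17 `LEVEL1-EXACT.md` Prop. B)

HONEST FRAMING: systematic search; no irrationality claim unless certified.  Elementary real analysis only (rational
functions, logarithms, the real dilogarithm `Li₂ = reDilog`); nothing here mentions the cellular integrals or `ζ(5)`.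
Companion of `WedgeDictionaryOneTopKernel` (whose `ftc_open` — FTC on an open interval for non-negative integrands — is the
tool), in the same `IntegrableOn ∧ value` + `ℝ≥0∞`-with-constant format:

1. `integral_t1` — the `t₁`-step `∫₀^b s/(c−s)² ds = b/(c−b) + log((c−b)/c)` (`0 < b < c`; the human's
   `t₂/(t₃−t₂) − log(t₃/(t₃−t₂))`), `t1_nonneg`, `t1_nonneg'`, `lintegral_t1`;
2. `integral_t3` — the `t₃`-step, where the dilogarithm enters:
   `∫_b^a [b + (s−b)log((s−b)/s)]/s ds = b(π²/6 − Li₂(b/a)) + (a−b)log((a−b)/a)` (`0 < b < a`), via the primitive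
   `−[b·Li₂(b/s) + (s−b)·log(s/(s−b))]` and its limit `−b·Li₂(1) = −bπ²/6` at `s = b⁺`; `t3_integrand_nonneg`, `t3_nonneg`,
   `lintegral_t3`;
3. `lintegral_comp_mul_left_Ioo` — the linear change of variables `∫⁻_{(0,c)} g = ∫⁻_{(0,1)} c·g(c·u) du` (`c > 0`) for
   `ℝ≥0∞`-valued integrands (a corollary of the tree's `Literature.Analysis.Complex.ExtremalLength.lintegral_Ioo_comp_mul`), used for the substitution `t₂ = t₄·y`.
Theorems only, no notation, no definition.
-/

noncomputable section

open MeasureTheory Set Filter Topology intervalIntegral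
open scoped ENNReal

namespace Summit.KontsevichZagierPeriods.Zeta5Search.WedgeDictionaryOneTop

open Literature.Analysis.SpecialFunctions (reDilog reDilog_one continuous_reDilog hasDerivAt_reDilog)

/-! ## 1. The `t₁`-step: `∫₀^b s/(c−s)² ds = b/(c−b) + log((c−b)/c)` (`0 < b < c`) -/

/-- The `t₁`-integral of the one-top integrand: for `0 < b < c`, `∫_{(0,b)} s/(c−s)² ds = b/(c−b) + log((c−b)/c)`
(primitive `c/(c−s) + log(c−s)`; gen-1 g17 `LEVEL1-EXACT.md` §3 "t₁ by (l1'''')": `t₂/(t₃−t₂) − log(t₃/(t₃−t₂))`),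
with integrability. [folklore] -/
theorem integral_t1 {b c : ℝ} (hb : 0 < b) (hbc : b < c) :
    IntegrableOn (fun s : ℝ => s / (c - s) ^ 2) (Ioo 0 b) ∧
      ∫ s in Ioo 0 b, s / (c - s) ^ 2 = b / (c - b) + Real.log ((c - b) / c) := by
  have key := ftc_open (F := fun s : ℝ => c / (c - s) + Real.log (c - s)) (f := fun s : ℝ => s / (c - s) ^ 2)
    (Fa := c / (c - 0) + Real.log (c - 0)) (Fb := c / (c - b) + Real.log (c - b)) hb ?_ ?_ ?_ ?_
  · refine ⟨key.1, ?_⟩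
    rw [key.2, sub_zero, Real.log_div (by linarith) (by linarith)]
    have h1 : c - b ≠ 0 := by linarith
    have h2 : c ≠ 0 := by linarith
    field_simp
    ring
  · intro s hs
    have hcs : c - s ≠ 0 := by linarith [hs.2]
    have h := ((hasDerivAt_const s c).div ((hasDerivAt_id' s).const_sub c) hcs).add
      (((hasDerivAt_id' s).const_sub c).log hcs)
    refine h.congr_deriv ?_
    field_simp
    ring
  · intro s hs
    have := hs.1.le
    positivity
  · have h1 : c - 0 ≠ 0 := by linarith
    exact ((by fun_prop (disch := assumption)) : ContinuousAt (fun s : ℝ => c / (c - s) + Real.log (c - s)) 0)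
      |>.tendsto.mono_left nhdsWithin_le_nhds
  · have h1 : c - b ≠ 0 := by linarith
    exact ((by fun_prop (disch := assumption)) : ContinuousAt (fun s : ℝ => c / (c - s) + Real.log (c - s)) b)
      |>.tendsto.mono_left nhdsWithin_le_nhds

/-- The value of the `t₁`-step is `≥ 0`. [folklore] -/
theorem t1_nonneg {b c : ℝ} (hb : 0 < b) (hbc : b < c) : 0 ≤ b / (c - b) + Real.log ((c - b) / c) := by
  rw [← (integral_t1 hb hbc).2]
  exact setIntegral_nonneg measurableSet_Ioo fun s hs => by have := hs.1.le; positivity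

/-- Equivalent form used downstream: `b + (c − b)·log((c−b)/c) ≥ 0` for `0 < b < c`. [folklore] -/
theorem t1_nonneg' {b c : ℝ} (hb : 0 < b) (hbc : b < c) : 0 ≤ b + (c - b) * Real.log ((c - b) / c) := by
  have h := mul_nonneg (by linarith : (0:ℝ) ≤ c - b) (t1_nonneg hb hbc)
  have h1 : c - b ≠ 0 := by linarith
  calc (0:ℝ) ≤ (c - b) * (b / (c - b) + Real.log ((c - b) / c)) := h
    _ = b + (c - b) * Real.log ((c - b) / c) := by field_simp

/-- `ℝ≥0∞` form of the `t₁`-step with a constant factor `K ≥ 0`. [folklore] -/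
theorem lintegral_t1 {b c K : ℝ} (hb : 0 < b) (hbc : b < c) (hK : 0 ≤ K) :
    ∫⁻ s in Ioo 0 b, ENNReal.ofReal (K * (s / (c - s) ^ 2)) =
      ENNReal.ofReal (K * (b / (c - b) + Real.log ((c - b) / c))) := by
  obtain ⟨hI, hv⟩ := integral_t1 hb hbc
  have hnn : 0 ≤ᵐ[volume.restrict (Ioo 0 b)] fun s => K * (s / (c - s) ^ 2) :=
    (ae_restrict_mem measurableSet_Ioo).mono fun s hs => by have := hs.1.le; positivity
  rw [← ofReal_integral_eq_lintegral_ofReal (hI.const_mul K) hnn, MeasureTheory.integral_const_mul, hv]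

/-! ## 2. The `t₃`-step: `∫_b^a [b + (s−b) log((s−b)/s)]/s ds = b(π²/6 − Li₂(b/a)) + (a−b) log((a−b)/a)` (`0 < b < a`) -/

/-- The `t₃`-integrand is non-negative: `b + (s − b) log((s−b)/s) ≥ 0` for `0 < b < s`
(`log x ≥ 1 − 1/x`). [folklore] -/
theorem t3_integrand_nonneg {b s : ℝ} (hb : 0 < b) (hbs : b < s) :
    0 ≤ (b + (s - b) * Real.log ((s - b) / s)) / s := by
  have hs : 0 < s := hb.trans hbs
  have hx : 0 < (s - b) / s := div_pos (by linarith) hs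
  have hlog := Real.one_sub_inv_le_log_of_pos hx
  have hsb : 0 ≤ s - b := by linarith
  have h1 : (s - b) * (1 - ((s - b) / s)⁻¹) ≤ (s - b) * Real.log ((s - b) / s) :=
    mul_le_mul_of_nonneg_left hlog hsb
  have h2 : (s - b) * (1 - ((s - b) / s)⁻¹) = -b := by
    have : s - b ≠ 0 := by linarith
    field_simp
    ring
  rw [h2] at h1
  exact div_nonneg (by linarith) hs.le

/-- The `t₃`-integral of the one-top integrand: for `0 < b < a`,
`∫_{(b,a)} [b + (s−b) log((s−b)/s)]/s ds = b(π²/6 − Li₂(b/a)) + (a−b) log((a−b)/a)` with integrability — the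
primitive is `−[b Li₂(b/s) + (s−b) log(s/(s−b))]` (gen-1 g17 `LEVEL1-EXACT.md` §3: substitution `x = t₂/t₃`, primitive
`Λ(1−x)/x + Li₂(x)`), whose limit at `s = b⁺` is `−b·Li₂(1) = −bπ²/6`. [folklore] -/
theorem integral_t3 {a b : ℝ} (hb : 0 < b) (hba : b < a) :
    IntegrableOn (fun s : ℝ => (b + (s - b) * Real.log ((s - b) / s)) / s) (Ioo b a) ∧
      ∫ s in Ioo b a, (b + (s - b) * Real.log ((s - b) / s)) / s =
        b * (Real.pi ^ 2 / 6 - reDilog (b / a)) + (a - b) * Real.log ((a - b) / a) := by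
  have ha : 0 < a := hb.trans hba
  have key := ftc_open (F := fun s : ℝ => -b * reDilog (b / s) + (s - b) * Real.log ((s - b) / s))
    (f := fun s : ℝ => (b + (s - b) * Real.log ((s - b) / s)) / s)
    (Fa := -b * reDilog 1 + 0) (Fb := -b * reDilog (b / a) + (a - b) * Real.log ((a - b) / a)) hba ?_ ?_ ?_ ?_
  · refine ⟨key.1, ?_⟩
    rw [key.2, reDilog_one]
    ring
  · intro s hs
    have hs0 : 0 < s := hb.trans hs.1
    have hs' : s ≠ 0 := hs0.ne'
    have hsb : s - b ≠ 0 := by linarith [hs.1]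
    have hx0 : b / s ≠ 0 := div_ne_zero hb.ne' hs'
    have hx1 : b / s ≠ 1 := by
      intro h; rw [div_eq_one_iff_eq hs'] at h; linarith [hs.1]
    have hD : HasDerivAt (fun s : ℝ => reDilog (b / s)) (-(Real.log (1 - b / s) / (b / s)) * (-b / s ^ 2)) s := by
      have hin : HasDerivAt (fun s : ℝ => b / s) (-b / s ^ 2) s := by
        have h := (hasDerivAt_const s b).div (hasDerivAt_id' s) hs'
        refine h.congr_deriv ?_
        field_simp
        ring
      exact (hasDerivAt_reDilog hx0 hx1).comp s hin
    have hlog1 : Real.log (1 - b / s) = Real.log ((s - b) / s) := by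
      congr 1; field_simp
    rw [hlog1] at hD
    have hL : HasDerivAt (fun s : ℝ => Real.log ((s - b) / s)) (b / (s * (s - b))) s := by
      have hin : HasDerivAt (fun s : ℝ => (s - b) / s) ((1 * s - (s - b) * 1) / s ^ 2) s :=
        ((hasDerivAt_id' s).sub_const b).div (hasDerivAt_id' s) hs'
      have h := hin.log (div_ne_zero hsb hs')
      refine h.congr_deriv ?_
      field_simp
      ring
    have h := (hD.const_mul (-b)).add (((hasDerivAt_id' s).sub_const b).mul hL)
    refine h.congr_deriv ?_
    generalize Real.log ((s - b) / s) = A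
    field_simp
    ring
  · intro s hs
    exact t3_integrand_nonneg hb hs.1
  · -- limit at `b⁺`: `Li₂(b/s) → Li₂(1)` and `(s − b) log((s−b)/s) → 0`
    have hc : Continuous reDilog := continuous_reDilog
    have h1 : Tendsto (fun s : ℝ => -b * reDilog (b / s)) (𝓝[>] b) (𝓝 (-b * reDilog 1)) := by
      have h : ContinuousAt (fun s : ℝ => -b * reDilog (b / s)) b := by
        have hb' : b ≠ 0 := hb.ne'
        fun_prop (disch := assumption)
      have := h.tendsto
      rw [div_self hb.ne'] at this
      exact this.mono_left nhdsWithin_le_nhds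
    have hml : Continuous (fun x : ℝ => x * Real.log x) := Real.continuous_mul_log
    have h2a : Tendsto (fun s : ℝ => (s - b) * Real.log (s - b)) (𝓝 b) (𝓝 0) := by
      have h := (hml.comp (continuous_sub_right b)).tendsto b
      simpa [Function.comp_def] using h
    have h2b : Tendsto (fun s : ℝ => (s - b) * Real.log s) (𝓝 b) (𝓝 ((b - b) * Real.log b)) :=
      ((continuous_sub_right b).tendsto b).mul (Real.continuousAt_log hb.ne').tendsto
    rw [sub_self, zero_mul] at h2b
    have h2 : Tendsto (fun s : ℝ => (s - b) * Real.log ((s - b) / s)) (𝓝[>] b) (𝓝 0) := by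
      have h := (h2a.sub h2b).mono_left (nhdsWithin_le_nhds (s := Ioi b))
      rw [sub_zero] at h
      refine h.congr' ?_
      filter_upwards [self_mem_nhdsWithin] with s hs
      have hs' : (0:ℝ) < s := hb.trans hs
      rw [Real.log_div (by linarith [show b < s from hs]) hs'.ne']
      ring
    exact h1.add h2
  · have hc : Continuous reDilog := continuous_reDilog
    have ha' : a ≠ 0 := ha.ne'
    have hab : a - b ≠ 0 := by linarith
    have hab' : (a - b) / a ≠ 0 := div_ne_zero hab ha'
    have h : ContinuousAt (fun s : ℝ => -b * reDilog (b / s) + (s - b) * Real.log ((s - b) / s)) a := by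
      fun_prop (disch := assumption)
    exact h.tendsto.mono_left nhdsWithin_le_nhds

/-- The value of the `t₃`-step is `≥ 0`. [folklore] -/
theorem t3_nonneg {a b : ℝ} (hb : 0 < b) (hba : b < a) :
    0 ≤ b * (Real.pi ^ 2 / 6 - reDilog (b / a)) + (a - b) * Real.log ((a - b) / a) := by
  rw [← (integral_t3 hb hba).2]
  exact setIntegral_nonneg measurableSet_Ioo fun s hs => t3_integrand_nonneg hb hs.1

/-- `ℝ≥0∞` form of the `t₃`-step with a constant factor `K ≥ 0`. [folklore] -/
theorem lintegral_t3 {a b K : ℝ} (hb : 0 < b) (hba : b < a) (hK : 0 ≤ K) :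
    ∫⁻ s in Ioo b a, ENNReal.ofReal (K * ((b + (s - b) * Real.log ((s - b) / s)) / s)) =
      ENNReal.ofReal (K * (b * (Real.pi ^ 2 / 6 - reDilog (b / a)) + (a - b) * Real.log ((a - b) / a))) := by
  obtain ⟨hI, hv⟩ := integral_t3 hb hba
  have hnn : 0 ≤ᵐ[volume.restrict (Ioo b a)] fun s => K * ((b + (s - b) * Real.log ((s - b) / s)) / s) :=
    (ae_restrict_mem measurableSet_Ioo).mono fun s hs => mul_nonneg hK (t3_integrand_nonneg hb hs.1)
  rw [← ofReal_integral_eq_lintegral_ofReal (hI.const_mul K) hnn, MeasureTheory.integral_const_mul, hv]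

/-! ## 3. The linear substitution `s = c·u` in a Lebesgue integral over `(0,c)` -/

/-- Linear change of variables for `ℝ≥0∞`-valued integrands: for `c > 0`, `∫⁻_{(0,c)} g = ∫⁻_{(0,1)} c · g(c·u) du`
(a corollary of the tree's `Literature.Analysis.Complex.ExtremalLength.lintegral_Ioo_comp_mul`). [folklore] -/
theorem lintegral_comp_mul_left_Ioo {c : ℝ} (hc : 0 < c) (g : ℝ → ℝ≥0∞) :
    ∫⁻ s in Ioo 0 c, g s = ∫⁻ u in Ioo (0:ℝ) 1, ENNReal.ofReal c * g (c * u) := by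
  rw [lintegral_const_mul' _ _ ENNReal.ofReal_ne_top, Literature.Analysis.Complex.ExtremalLength.lintegral_Ioo_comp_mul g hc,
    ← mul_assoc, ← ENNReal.ofReal_mul hc.le, mul_inv_cancel₀ hc.ne', ENNReal.ofReal_one, one_mul]

end Summit.KontsevichZagierPeriods.Zeta5Search.WedgeDictionaryOneTop
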